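import Literature.Computability.AlgebraicComplexity.ApproxDecompositionCertificate
import HarnessLib

/-!
# Integer certificates for exact decompositions over a simple algebraic extension (`R(t) ≤ r`, `bR(t) ≤ r` over fields containing a root), checked by `decide`

Topic `Literature/Computability/AlgebraicComplexity`; a trunk-independent TOOL, the companion of
`ApproxDecompositionCertificate.lean` (integer certificates `ApproxCert.check` for approximate
decompositions with INTEGER / rational data) for EXACT decompositions whose entries live in a
number field `ℚ(θ)` — typically a cyclotomic field (structure tensors of group algebras `K[ℤ/n]`,
tensors whose best decompositions use `i` or a cube root of unity) or the field generated by a root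
of an explicit polynomial found by a numerical search + rationalisation.  Everything here is PROVED;
nothing is specific to one tensor or one field.

The device [folklore; cf. Bläser 2013, §4 and Def. 6.1, Bürgisser–Clausen–Shokrollahi 1997, §14.1
(rank depends on the field; decompositions over extension fields)]: write every entry of the
decomposition as an INTEGER polynomial in a formal generator `z` (after clearing denominators into
one integer multiplier `D`), and let `F ∈ ℤ[z]` be (an integer multiple of) the minimal polynomial of
`θ`.  Then `∑_{ρ<r} u_ρ ⊗ v_ρ ⊗ w_ρ = D · t` holds in `ℚ(θ)` as soon as the integer polynomial identity

  `∑_ρ U_ρ,i(z) · V_ρ,j(z) · W_ρ,l(z) = D · t_{ijl} + F(z) · Q_{ijl}(z)`   in `ℤ[z]`, for every entry,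

holds for some quotient polynomials `Q_{ijl} ∈ ℤ[z]` (supplied WITH the certificate, so that the
check is division-free: schoolbook products, a difference, and "all coefficients vanish"), and this
identity evaluates, in ANY commutative ring `K` at ANY root `θ ∈ K` of `F`, to an exact decomposition
of `D · t` with `r` triads over `K`.

* `AlgExtCert.check a b c r F D T U V W Q` — the Boolean check of the displayed identities for an
  integer tensor `T : Fin a → Fin b → Fin c → ℤ` (`U ρ i, V ρ j, W ρ l, Q i j l : List ℤ` ascending
  coefficient lists in `z`; `F : List ℤ`);
* `AlgExtCert.eq_sum_triad_of_check` — soundness: at a root `θ` of `F` in a commutative ring `K`,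
  `D · T = ∑_ρ U_ρ(θ) ⊗ V_ρ(θ) ⊗ W_ρ(θ)`;
* `AlgExtCert.tensorRank_le_of_check`, `algBorderRank_le_of_check` — hence `R(T) ≤ r` and
  `bR(T) ≤ r` over every commutative ring `K` containing a root of `F` in which `D` is a unit.

The integer polynomial arithmetic on coefficient lists (`toPoly`, `padd`, `psmul`, `pmul`, `psum` and
their homomorphism lemmas) is REUSED from `BorderRankMatMulSmallProofs.lean` (namespace `Smirnov2013`)
exactly as in `ApproxDecompositionCertificate.lean`, whose sparse input format `ApproxCert.ofEntries`
the client tables share.  Intended use: `theorem foo_nfCheck : AlgExtCert.check … = true := by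
decide +kernel` on literal data, then the soundness theorems with the root hypothesis
`AlgExtCert.evalL θ F = 0` (for a literal `F` this is a polynomial equation in `θ`, e.g.
`θ ^ 2 + θ + 1 = 0`, discharged from such a hypothesis by `simp [AlgExtCert.evalL]; linear_combination h`).
Certificates are FOUND outside Lean; only their verification is in the kernel.

First clients: the rows of the small-tensor border-rank census (`SmallTensorBorderRank*.lean`) whose
optimal decompositions need a root of unity or another algebraic irrationality
(`SmallTensorBorderRankAlgExt.lean`).

## References

* [Blaser2013] M. Bläser, *Fast Matrix Multiplication*, Theory of Computing Library, Graduate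
  Surveys 5 (2013) — §4 (rank, triads), Def. 6.1, Rem. 6.2 (`R_0 = R`, `bR ≤ R_h`).
* [BurgisserClausenShokrollahi1997] P. Bürgisser, M. Clausen, M. A. Shokrollahi, *Algebraic
  Complexity Theory*, Springer 1997 — §14.1 (rank and the ground field), §15.4.
-/

noncomputable section

open scoped BigOperators Polynomial
open Polynomial

namespace Literature.Computability.AlgebraicComplexity

namespace AlgExtCert

open Smirnov2013 (toPoly padd psmul pmul psum toPoly_padd toPoly_psmul toPoly_pmul toPoly_psum)

section Poly

variable {K : Type*} [CommRing K]

/-- `pzero l`: every listed coefficient is `0` (one pass). [folklore] -/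
def pzero : List ℤ → Bool
  | [] => true
  | c :: cs => (c == 0) && pzero cs

/-- A list with vanishing coefficients is the zero polynomial. [folklore] -/
theorem toPoly_eq_zero_of_pzero : ∀ l : List ℤ, pzero l = true → (toPoly l : K[X]) = 0
  | [], _ => rfl
  | c :: cs, h => by
    simp only [pzero, Bool.and_eq_true, beq_iff_eq] at h
    rw [toPoly, h.1, toPoly_eq_zero_of_pzero cs h.2, Int.cast_zero, C_0, mul_zero, add_zero]

/-- Horner evaluation of an ascending integer coefficient list at `θ ∈ K`. [folklore] -/
def evalL (θ : K) : List ℤ → K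
  | [] => 0
  | c :: cs => (c : K) + θ * evalL θ cs

/-- Horner evaluation of the empty list. [folklore] -/
@[simp] theorem evalL_nil (θ : K) : evalL θ [] = 0 := rfl

/-- Horner evaluation, one step. [folklore] -/
@[simp] theorem evalL_cons (θ : K) (c : ℤ) (cs : List ℤ) :
    evalL θ (c :: cs) = (c : K) + θ * evalL θ cs := rfl

/-- `evalL θ l` is the value of the polynomial `toPoly l` at `θ`. [folklore] -/
theorem eval_toPoly (θ : K) : ∀ l : List ℤ, (toPoly l : K[X]).eval θ = evalL θ l
  | [] => by simp [toPoly]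
  | c :: cs => by rw [toPoly, eval_add, eval_C, eval_mul, eval_X, eval_toPoly θ cs, evalL_cons]

end Poly

/-! ## The certificate check -/

/-- The `(i,j,l)` entry polynomial `∑_ρ U_ρ(z) V_ρ(z) W_ρ(z) ∈ ℤ[z]` (schoolbook, no reduction), for
the coefficient lists `U ρ = U_ρ,i`, `V ρ = V_ρ,j`, `W ρ = W_ρ,l` of the `r` triads at a fixed entry.
[cite: Blaser2013, §4 (rank of a tensor, after Def. 4.5)] -/
def entryPolyZ (r : ℕ) (U V W : Fin r → List ℤ) : List ℤ :=
  psum (List.ofFn fun ρ : Fin r => pmul (pmul (U ρ) (V ρ)) (W ρ))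

/-- **The certificate check** of an exact `r`-term decomposition of `D · T` with entries in
`ℤ[z]/(F)`: for every entry `(i,j,l)` the integer polynomial
`∑_ρ U ρ i · V ρ j · W ρ l - D · T i j l - F · Q i j l` vanishes identically.  Meant to be evaluated by
`decide` / `decide +kernel`. [cite: Blaser2013, §4 (rank of a tensor, after Def. 4.5)] -/
def check (a b c r : ℕ) (F : List ℤ) (D : ℤ) (T : Fin a → Fin b → Fin c → ℤ)
    (U : Fin r → Fin a → List ℤ) (V : Fin r → Fin b → List ℤ) (W : Fin r → Fin c → List ℤ)
    (Q : Fin a → Fin b → Fin c → List ℤ) : Bool :=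
  (List.finRange a).all fun i => (List.finRange b).all fun j => (List.finRange c).all fun l =>
    pzero (padd (entryPolyZ r (fun ρ => U ρ i) (fun ρ => V ρ j) (fun ρ => W ρ l))
      (padd [-(D * T i j l)] (psmul (-1) (pmul F (Q i j l)))))

/-! ## Soundness -/

section Sound

variable {K : Type*} [CommRing K]

/-- The entry polynomial is the sum of the triple products in `K[z]`. [folklore] -/
theorem toPoly_entryPolyZ (r : ℕ) (U V W : Fin r → List ℤ) :
    (toPoly (entryPolyZ r U V W) : K[X]) = ∑ ρ, toPoly (U ρ) * toPoly (V ρ) * toPoly (W ρ) := by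
  rw [entryPolyZ, toPoly_psum, List.map_ofFn, List.sum_ofFn]
  exact Finset.sum_congr rfl fun ρ _ => by simp only [Function.comp_apply, toPoly_pmul]

/-- Unpacking a successful check at a root `θ` of `F`: entry by entry,
`∑_ρ U_ρ,i(θ) V_ρ,j(θ) W_ρ,l(θ) = D · T i j l`. [cite: Blaser2013, §4 (rank of a tensor, after Def. 4.5)] -/
theorem sum_eval_eq_of_check {a b c r : ℕ} {F : List ℤ} {D : ℤ} {T : Fin a → Fin b → Fin c → ℤ}
    {U : Fin r → Fin a → List ℤ} {V : Fin r → Fin b → List ℤ} {W : Fin r → Fin c → List ℤ}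
    {Q : Fin a → Fin b → Fin c → List ℤ} (hc : check a b c r F D T U V W Q = true) {θ : K}
    (hθ : evalL θ F = 0) (i : Fin a) (j : Fin b) (l : Fin c) :
    ∑ ρ, evalL θ (U ρ i) * evalL θ (V ρ j) * evalL θ (W ρ l) = (D * T i j l : ℤ) := by
  simp only [check, List.all_eq_true] at hc
  have h0 := toPoly_eq_zero_of_pzero (K := K) _
    (hc i (List.mem_finRange i) j (List.mem_finRange j) l (List.mem_finRange l))
  rw [toPoly_padd, toPoly_padd, toPoly_psmul, toPoly_pmul, toPoly_entryPolyZ] at h0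
  have h1 := congrArg (Polynomial.eval θ) h0
  rw [eval_add, eval_add, eval_finsetSum, eval_mul, eval_mul, eval_C, eval_toPoly θ F, hθ,
    zero_mul, mul_zero, add_zero, eval_zero, eval_toPoly] at h1
  simp only [eval_mul, eval_toPoly, evalL_cons, evalL_nil, mul_zero, add_zero, Int.cast_neg] at h1
  rw [← sub_eq_add_neg, sub_eq_zero] at h1
  exact h1

/-- **Soundness.** At a root `θ ∈ K` of `F`, a successful check is an exact decomposition of `D · T`
into `r` triads over `K`. [cite: Blaser2013, §4 (rank of a tensor, after Def. 4.5)] -/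
theorem eq_sum_triad_of_check {a b c r : ℕ} {F : List ℤ} {D : ℤ} {T : Fin a → Fin b → Fin c → ℤ}
    {U : Fin r → Fin a → List ℤ} {V : Fin r → Fin b → List ℤ} {W : Fin r → Fin c → List ℤ}
    {Q : Fin a → Fin b → Fin c → List ℤ} (hc : check a b c r F D T U V W Q = true) {θ : K}
    (hθ : evalL θ F = 0) :
    (fun i j l => (D : K) * (T i j l : K)) =
      ∑ ρ, triad (fun i => evalL θ (U ρ i)) (fun j => evalL θ (V ρ j)) (fun l => evalL θ (W ρ l)) := by
  funext i j l
  rw [Finset.sum_apply, Finset.sum_apply, Finset.sum_apply]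
  simp only [triad_apply]
  rw [sum_eval_eq_of_check hc hθ i j l, Int.cast_mul]

/-- **`R_0(T) ≤ r`** at a root of `F`, over every commutative ring in which the multiplier `D` is a
unit. [cite: Blaser2013, Rem. 6.2] -/
theorem approxRank_zero_le_of_check (K : Type*) [CommRing K] {a b c r : ℕ} {F : List ℤ} {D : ℤ}
    {T : Fin a → Fin b → Fin c → ℤ} {U : Fin r → Fin a → List ℤ} {V : Fin r → Fin b → List ℤ}
    {W : Fin r → Fin c → List ℤ} {Q : Fin a → Fin b → Fin c → List ℤ}
    (hc : check a b c r F D T U V W Q = true) {θ : K} (hθ : evalL θ F = 0) (hD : IsUnit (D : K)) :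
    approxRank 0 (fun i j l => (T i j l : K)) ≤ r :=
  ApproxCert.approxRank_le_of_isApproxDecomposition_mul hD
    (isApproxDecomposition_zero_C (eq_sum_triad_of_check hc hθ))

/-- **`R(T) ≤ r`** over every commutative ring containing a root `θ` of `F` in which `D` is a unit.
[cite: Blaser2013, §4 (rank of a tensor, after Def. 4.5)] -/
theorem tensorRank_le_of_check (K : Type*) [CommRing K] {a b c r : ℕ} {F : List ℤ} {D : ℤ}
    {T : Fin a → Fin b → Fin c → ℤ} {U : Fin r → Fin a → List ℤ} {V : Fin r → Fin b → List ℤ}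
    {W : Fin r → Fin c → List ℤ} {Q : Fin a → Fin b → Fin c → List ℤ}
    (hc : check a b c r F D T U V W Q = true) {θ : K} (hθ : evalL θ F = 0) (hD : IsUnit (D : K)) :
    tensorRank (fun i j l => (T i j l : K)) ≤ r :=
  (approxRank_zero _).symm.le.trans (approxRank_zero_le_of_check K hc hθ hD)

/-- **`bR(T) ≤ r`** over every commutative ring containing a root `θ` of `F` in which `D` is a unit
(`bR ≤ R_0 = R`). [cite: Blaser2013, Rem. 6.2] -/
theorem algBorderRank_le_of_check (K : Type*) [CommRing K] {a b c r : ℕ} {F : List ℤ} {D : ℤ}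
    {T : Fin a → Fin b → Fin c → ℤ} {U : Fin r → Fin a → List ℤ} {V : Fin r → Fin b → List ℤ}
    {W : Fin r → Fin c → List ℤ} {Q : Fin a → Fin b → Fin c → List ℤ}
    (hc : check a b c r F D T U V W Q = true) {θ : K} (hθ : evalL θ F = 0) (hD : IsUnit (D : K)) :
    algBorderRank (fun i j l => (T i j l : K)) ≤ r :=
  (algBorderRank_le_approxRank 0 _).trans (approxRank_zero_le_of_check K hc hθ hD)

end Sound

/-! ## Sparse input format for the quotients -/

/-- The entrywise table of coefficient lists given by a sparse list `((i, j, l), list)` (first match;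
the empty list elsewhere) — the input format of the quotients `Q` in the certificate tables.
[folklore] -/
def ofEntriesL (a b c : ℕ) (E : List ((ℕ × ℕ × ℕ) × List ℤ)) : Fin a → Fin b → Fin c → List ℤ :=
  fun i j l => ((E.find? fun e => e.1 == (i.val, j.val, l.val)).map Prod.snd).getD []

/-! ## A worked example: `R(K[ℤ/3]) ≤ 3` at a root of `z² + z + 1` -/

/-- The structure tensor of the group algebra `K[ℤ/3]` in the basis of group elements:
entries `((i, j, i + j mod 3), 1)`. [cite: Blaser2013, §4 (rank of a tensor, after Def. 4.5)] -/
def cyclicGroupAlgebra3 : Fin 3 → Fin 3 → Fin 3 → ℤ :=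
  ApproxCert.ofEntries 3 3 3 [((0, 0, 0), 1), ((0, 1, 1), 1), ((0, 2, 2), 1), ((1, 0, 1), 1),
    ((1, 1, 2), 1), ((1, 2, 0), 1), ((2, 0, 2), 1), ((2, 1, 0), 1), ((2, 2, 1), 1)]

/-- The discrete Fourier transform over `ℤ[z]/(z² + z + 1)`:
`3 · K[ℤ/3] = ∑_{k<3} χ_k ⊗ χ_k ⊗ χ_{-k}` with `χ_k = (1, z^k, z^{2k})` reduced modulo `F = z² + z + 1`,
certified with explicit quotients. [cite: Blaser2013, §4 (rank of a tensor, after Def. 4.5)] -/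
theorem cyclicGroupAlgebra3_check :
    check 3 3 3 3 [1, 1, 1] 3 cyclicGroupAlgebra3
      (![![[1], [1], [1]], ![[1], [0, 1], [-1, -1]], ![[1], [-1, -1], [0, 1]]])
      (![![[1], [1], [1]], ![[1], [0, 1], [-1, -1]], ![[1], [-1, -1], [0, 1]]])
      (![![[1], [1], [1]], ![[1], [-1, -1], [0, 1]], ![[1], [0, 1], [-1, -1]]])
      (ofEntriesL 3 3 3 [((0, 1, 1), [-2]), ((0, 1, 2), [2]), ((0, 2, 1), [2]),
        ((0, 2, 2), [-2]), ((1, 0, 1), [-2]), ((1, 0, 2), [2]), ((1, 1, 0), [2]),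
        ((1, 1, 1), [1]), ((1, 1, 2), [-3]), ((1, 2, 0), [-2]), ((1, 2, 1), [1]),
        ((1, 2, 2), [1]), ((2, 0, 1), [2]), ((2, 0, 2), [-2]), ((2, 1, 0), [-2]),
        ((2, 1, 1), [1]), ((2, 1, 2), [1]), ((2, 2, 0), [2]), ((2, 2, 1), [-3]),
        ((2, 2, 2), [1])]) = true := by
  decide +kernel

/-- `R(K[ℤ/3]) ≤ 3` over every commutative ring containing a root of `z² + z + 1` in which `3` is a
unit. [cite: Blaser2013, §4 (rank of a tensor, after Def. 4.5)] -/
theorem tensorRank_cyclicGroupAlgebra3_le (K : Type*) [CommRing K] (θ : K)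
    (hθ : θ ^ 2 + θ + 1 = 0) (h3 : IsUnit (3 : K)) :
    tensorRank (fun i j l => (cyclicGroupAlgebra3 i j l : K)) ≤ 3 :=
  tensorRank_le_of_check K cyclicGroupAlgebra3_check (θ := θ)
    (by simp only [evalL_cons, evalL_nil, Int.cast_one, mul_zero, add_zero]; linear_combination hθ)
    (by simpa using h3)

end AlgExtCert

end Literature.Computability.AlgebraicComplexity
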